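import Literature.Computability.AlgebraicComplexity.GenericSubspaceChartCriterion
import Mathlib.Algebra.Polynomial.Taylor
import Mathlib.Algebra.Polynomial.Div
import Mathlib.Algebra.MvPolynomial.Equiv
import Mathlib.Algebra.CharP.Lemmas
import Mathlib.RingTheory.MvPolynomial.Basic
import HarnessLib

/-!
# Forms fixed by a transvection in characteristic `p` (Dickson / Landweber–Stong invariants)

Topic `Literature/Computability/AlgebraicComplexity` (cell `val-lit`, row X3-Poonen05). Theorems only —
no definition, no named fact.

In characteristic `p > 0` the cyclic group `ℤ/p` generated by a transvection
`τ₀ : x_j ↦ x_j + x_i` (all other variables fixed) has the polynomial invariant ring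
`K[x]^{ℤ/p} = K[x_k (k ≠ j), c_p(x_j)]`, `c_p(x_j) = x_j^p - x_i^{p-1} x_j = ∏_{a ∈ 𝔽_p} (x_j + a x_i)`
(the top Chern class of the orbit of `x_j`) — Neusel–Smith, *Invariant Theory of Finite Groups*,
§6.3 Example 1 (p0167: "`𝔽[x,y]^{ℤ/p} = 𝔽[c_p(x), y]`") and the Landweber–Stong groups of §6.2
(Thm. 6.2.6, p0165). We follow the elementary road (self-contained): division by the monic invariant
`c_p` in `A[X]`, `A = K[x_k : k ≠ j]`, uniqueness of quotient and remainder, and "an invariant of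
`X`-degree `< p` is constant" (compare the coefficient of `X^{d-1}`: `d · c · lc ≠ 0`). The output is
the dimension bound the Matsumura–Monsky count (Poonen 2005 Thm. 3) needs for the transvection class:
`dim (Sym^D K^σ)^{τ₀} ≤ #T`, `T` = monomials `x^e` with `|e| + (p-1) e_j = D` (the monomials
`x^{e'} c_p(x_j)^{b}` of degree `D`).

* § 1 (univariate, `A` a domain of characteristic `p`, `c ≠ 0`) `transvectionPoly_comp_X_add_C`
  (`c_p` is invariant under `X ↦ X + c`), `eq_C_of_comp_X_add_C_eq` (invariants of degree `< p` are
  constants), `exists_eq_comp_transvectionPoly` (every invariant is a polynomial in `c_p`).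
* § 2 (transport to `MvPolynomial σ K` through `optionEquivLeft`) `linSubst_transvection_X`,
  `exists_eq_bind₁_of_linSubst_transvection_eq` — a polynomial fixed by `τ₀ = 1 + E_{ij}` is
  `G(x_j ↦ c_p(x_j))` for some polynomial `G`.
* § 3 (grading) `isHomogeneous_bind₁_transvectionGen_monomial` (the substituted monomial `x^e` is a
  form of degree `|e| + (p-1) e_j`), `mem_map_restrictSupport_of_linSubst_transvection_eq` and
  **`finrank_fixedForms_transvection_le_card`** — `dim (Sym^D)^{τ₀} ≤ #T`.

Honest framing: classical modular invariant theory ([NeuselSmith2010] §6.2–6.3; L. E. Dickson 1911);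
used by the same seat for "generic forms admit no transvection symmetry" and Poonen 2005 Thm. 3 for
plane curves; typed ≠ endorsed; nothing here bears on VP versus VNP, which is NOT proved.

## References

* M. Neusel, L. Smith, *Invariant Theory of Finite Groups*, Math. Surveys Monogr. 94, AMS (2002/2010),
  §6.2 Thm. 6.2.6 (p0165), §6.3 Example 1 (p0167) (held: book:neusel2010-invariant-theory-finite-groups).
  [NeuselSmith2010]
* B. Poonen, *Varieties without extra automorphisms III: hypersurfaces*, Finite Fields Appl. 11
  (2005) 230–268, Thm. 3 (held, p0002:L17–21). [Poonen2005]

## Tree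

`linSubst`, `linSubst_X` (`LinSubst`); `degMonomials`, `mem_degMonomials_iff` (`OrbitCoordinateRing`);
`finiteDimensional_homogeneousSubmodule` (`GenericSubspaceChartCriterion`).

## Provenance

Cell `val-lit`, seat `val-lit-x3` generation 9 (cross-ladder literature seat; row X3 residue).
-/

noncomputable section

namespace Literature.Computability.AlgebraicComplexity

/-! ### § 1 Univariate: invariants of `X ↦ X + c` in `A[X]`, `A` a domain of characteristic `p` -/

section Univariate

open _root_.Polynomial

variable {A : Type*} [CommRing A] (p : ℕ) [Fact p.Prime]

/-- `c_p = X^p - c^{p-1} X` is monic. [cite: NeuselSmith2010, §6.3 Example 1 (p0167)] -/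
theorem transvectionPoly_monic [Nontrivial A] (c : A) : (X ^ p - C (c ^ (p - 1)) * X : A[X]).Monic := by
  have hp : 2 ≤ p := (Fact.out : p.Prime).two_le
  refine (monic_X_pow p).sub_of_left ?_
  rw [degree_X_pow]
  refine (degree_C_mul_X_le _).trans_lt ?_
  exact_mod_cast hp

/-- `c_p = X^p - c^{p-1} X` has degree `p`. [cite: NeuselSmith2010, §6.3 Example 1 (p0167)] -/
theorem natDegree_transvectionPoly [Nontrivial A] (c : A) :
    (X ^ p - C (c ^ (p - 1)) * X : A[X]).natDegree = p := by
  have hp : 2 ≤ p := (Fact.out : p.Prime).two_le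
  rw [natDegree_sub_eq_left_of_natDegree_lt, natDegree_X_pow]
  rw [natDegree_X_pow]
  exact ((natDegree_C_mul_le _ _).trans natDegree_X_le).trans_lt hp

/-- **`c_p` is invariant**: `c_p(X + c) = c_p(X)` in characteristic `p`
(`(X + c)^p = X^p + c^p` and `c^{p-1}(X + c) = c^{p-1} X + c^p`; `c_p(X) = ∏_{a ∈ 𝔽_p} (X + a c)`).
[cite: NeuselSmith2010, §6.3 Example 1 (p0167)] -/
theorem transvectionPoly_comp_X_add_C [CharP A p] (c : A) :
    (X ^ p - C (c ^ (p - 1)) * X : A[X]).comp (X + C c) = X ^ p - C (c ^ (p - 1)) * X := by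
  have hp0 : p ≠ 0 := (Fact.out : p.Prime).ne_zero
  rw [sub_comp, X_pow_comp, mul_comp, C_comp, X_comp, add_pow_char, mul_add, ← C_pow, ← C_mul,
    pow_sub_one_mul hp0]
  ring

omit [Fact p.Prime] in
/-- **Invariants of `X`-degree `< p` are constants.** If `f(X + c) = f(X)` with `c ≠ 0` in a domain of
characteristic `p` and `deg f < p`, then `f` is constant: for `d = deg f ≥ 1` the coefficient of
`X^{d-1}` in `f(X + c) - f(X)` is `d · c · lc(f) ≠ 0`. [cite: NeuselSmith2010, §6.3 Example 1 (p0167)] -/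
theorem eq_C_of_comp_X_add_C_eq [IsDomain A] [CharP A p] {c : A} (hc : c ≠ 0) {f : A[X]} (hf : f.comp (X + C c) = f)
    (hdeg : f.natDegree < p) : f = C (f.coeff 0) := by
  by_contra hne
  have hd : 0 < f.natDegree := by
    rcases Nat.eq_zero_or_pos f.natDegree with h | h
    · exact absurd (eq_C_of_natDegree_eq_zero h) hne
    · exact h
  have hf0 : f ≠ 0 := by
    rintro rfl
    simp at hd
  set d := f.natDegree with hd_def
  -- the coefficient of `X^{d-1}` in `f(X + c)` is `f_{d-1} + d c f_d`
  have hH : (hasseDeriv (d - 1) f).natDegree < 2 := by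
    refine (natDegree_hasseDeriv_le f (d - 1)).trans_lt ?_
    omega
  have h1 : (taylor c f).coeff (d - 1) = f.coeff (d - 1) + (d : A) * f.coeff d * c := by
    rw [taylor_coeff, eval_eq_sum_range' hH, Finset.sum_range_succ, Finset.sum_range_one,
      hasseDeriv_coeff, hasseDeriv_coeff, zero_add, Nat.choose_self, Nat.cast_one, one_mul, pow_zero,
      mul_one, pow_one, show 1 + (d - 1) = d by omega,
      show d.choose (d - 1) = d by
        rw [← Nat.choose_symm (Nat.sub_le d 1), show d - (d - 1) = 1 by omega, Nat.choose_one_right]]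
  rw [taylor_apply, hf] at h1
  -- hence `d c f_d = 0`, a contradiction
  have h2 : (d : A) * f.coeff d * c = 0 := by
    have := h1
    rw [left_eq_add] at this
    exact this
  have hdA : (d : A) ≠ 0 := by
    intro h0
    have hpd : p ∣ d := (CharP.cast_eq_zero_iff A p d).mp h0
    exact absurd (Nat.le_of_dvd hd hpd) (not_le.mpr hdeg)
  have hlc : f.coeff d ≠ 0 := by
    rw [hd_def, coeff_natDegree]
    exact leadingCoeff_ne_zero.mpr hf0
  exact mul_ne_zero (mul_ne_zero hdA hlc) hc h2

/-- **Every invariant of `X ↦ X + c` is a polynomial in `c_p`** (`A` a domain of characteristic `p`,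
`c ≠ 0`): if `f(X + c) = f(X)` then `f = g(c_p)` for some `g ∈ A[X]`. Printed road
("`𝔽[x,y]^{ℤ/p} = 𝔽[c_p(x), y]`"), elementary version: divide by the monic invariant `c_p`; by
uniqueness quotient and remainder are invariant; the remainder has degree `< p`, hence is constant;
induct on the degree. [cite: NeuselSmith2010, §6.3 Example 1 (p0167)] -/
theorem exists_eq_comp_transvectionPoly [IsDomain A] [CharP A p] {c : A} (hc : c ≠ 0) :
    ∀ (n : ℕ) (f : A[X]), f.natDegree ≤ n → f.comp (X + C c) = f →
      ∃ g : A[X], f = g.comp (X ^ p - C (c ^ (p - 1)) * X) := by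
  have hp1 : 1 ≤ p := (Fact.out : p.Prime).one_le
  intro n
  induction n using Nat.strong_induction_on with
  | _ n ih =>
    intro f hfn hf
    by_cases hlt : f.natDegree < p
    · exact ⟨C (f.coeff 0), by rw [C_comp]; exact eq_C_of_comp_X_add_C_eq p hc hf hlt⟩
    · push Not at hlt
      have hQ := transvectionPoly_monic p c
      have hQdeg := natDegree_transvectionPoly p c
      have hQ1 : (X ^ p - C (c ^ (p - 1)) * X : A[X]) ≠ 1 := by
        intro h1
        have := congrArg natDegree h1
        rw [hQdeg, natDegree_one] at this
        omega
      set q := f /ₘ (X ^ p - C (c ^ (p - 1)) * X) with hq_def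
      set r := f %ₘ (X ^ p - C (c ^ (p - 1)) * X) with hr_def
      have hdecomp : r + (X ^ p - C (c ^ (p - 1)) * X) * q = f := modByMonic_add_div f _
      have hrdeg : r.natDegree < p := by
        have := natDegree_modByMonic_lt f hQ hQ1
        rwa [hQdeg] at this
      -- quotient and remainder are invariant (uniqueness of division by the invariant `c_p`)
      have hcomp : r.comp (X + C c) + (X ^ p - C (c ^ (p - 1)) * X) * q.comp (X + C c) = f := by
        conv_rhs => rw [← hf, ← hdecomp]
        rw [add_comp, mul_comp, transvectionPoly_comp_X_add_C]
      have hdeg' : (r.comp (X + C c)).degree < (X ^ p - C (c ^ (p - 1)) * X : A[X]).degree := by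
        apply degree_lt_degree
        rw [natDegree_comp, natDegree_X_add_C, mul_one, hQdeg]
        exact hrdeg
      obtain ⟨hq', hr'⟩ := div_modByMonic_unique (q.comp (X + C c)) (r.comp (X + C c)) hQ ⟨hcomp, hdeg'⟩
      rw [← hq_def] at hq'
      rw [← hr_def] at hr'
      -- the remainder is a constant, the quotient has smaller degree
      have hr := eq_C_of_comp_X_add_C_eq p hc hr'.symm hrdeg
      have hqdeg : q.natDegree < n := by
        have h1 : q.natDegree = f.natDegree - p := by rw [hq_def, natDegree_divByMonic f hQ, hQdeg]
        omega
      obtain ⟨g₁, hg₁⟩ := ih q.natDegree hqdeg q le_rfl hq'.symm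
      refine ⟨C (r.coeff 0) + X * g₁, ?_⟩
      rw [add_comp, mul_comp, X_comp, C_comp, ← hg₁, ← hr, hdecomp]

end Univariate

/-! ### § 2 Transport to `K[x_σ]`: polynomials fixed by the transvection `x_j ↦ x_j + x_i` -/

section Transport

open _root_.MvPolynomial

variable {σ : Type*} [Fintype σ] [DecidableEq σ] {K : Type*} [Field K]

/-- The model transvection on the variables: with `τ₀ = 1 + E_{ij}` the tree's `linSubst τ₀` maps
`x_j ↦ x_j + x_i` and fixes the other variables. [cite: NeuselSmith2010, §6.2 (p0162, transvections)] -/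
theorem linSubst_transvection_X {i j : σ} (hij : i ≠ j) (k : σ) :
    linSubst σ K (1 + Matrix.single i j (1 : K)) (X k) = if k = j then X j + X i else X k := by
  rw [linSubst_X]
  simp only [Matrix.add_apply, Matrix.one_apply, Matrix.single_apply, add_smul, Finset.sum_add_distrib,
    ite_smul, one_smul, zero_smul, Finset.sum_ite_eq', Finset.mem_univ, if_true]
  by_cases hk : k = j
  · subst hk
    simp [Finset.sum_ite_eq]
  · have hjk : ¬ j = k := fun h => hk h.symm
    simp [hjk, hk]

/-- **A polynomial fixed by a transvection is a polynomial in `c_p(x_j)`** (characteristic `p`): if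
`τ₀ · h = h` for `τ₀ : x_j ↦ x_j + x_i` then `h = G(x_j ↦ x_j^p - x_i^{p-1} x_j)` for some polynomial
`G ∈ K[x_σ]` — the statement "`K[x]^{ℤ/p} = K[x_k (k ≠ j), c_p(x_j)]`", transported from § 1 through
`K[x_σ] ≅ A[X]`, `A = K[x_k : k ≠ j]` (Mathlib `optionEquivLeft`).
[cite: NeuselSmith2010, §6.3 Example 1 (p0167)] -/
theorem exists_eq_bind₁_of_linSubst_transvection_eq {p : ℕ} [Fact p.Prime] [CharP K p] {i j : σ}
    (hij : i ≠ j) {h : MvPolynomial σ K} (hh : linSubst σ K (1 + Matrix.single i j (1 : K)) h = h) :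
    ∃ G : MvPolynomial σ K,
      h = bind₁ (fun k : σ => if k = j then X j ^ p - X i ^ (p - 1) * X j else X k) G := by
  classical
  -- the isomorphism `Φ : K[x_σ] ≅ A[X]`, `A = K[x_k : k ≠ j]`, `x_j ↦ X`, `x_k ↦ C x_k`
  let e : σ ≃ Option {k : σ // k ≠ j} := (Equiv.optionSubtypeNe j).symm
  let Φ : MvPolynomial σ K ≃ₐ[K] Polynomial (MvPolynomial {k : σ // k ≠ j} K) :=
    (renameEquiv K e).trans (optionEquivLeft K {k : σ // k ≠ j})
  set c : MvPolynomial {k : σ // k ≠ j} K := X ⟨i, hij⟩ with hc_def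
  have hc : c ≠ 0 := X_ne_zero _
  have hΦj : Φ (X j) = Polynomial.X := by
    change optionEquivLeft K _ (rename e (X j)) = _
    rw [rename_X, show e j = none from Equiv.optionSubtypeNe_symm_self j, optionEquivLeft_X_none]
  have hΦk : ∀ (k : σ) (hk : k ≠ j), Φ (X k) = Polynomial.C (X ⟨k, hk⟩) := by
    intro k hk
    change optionEquivLeft K _ (rename e (X k)) = _
    rw [rename_X, show e k = some ⟨k, hk⟩ from Equiv.optionSubtypeNe_symm_of_ne hk,
      optionEquivLeft_X_some]
  -- `Φ` intertwines `τ₀` with `X ↦ X + c`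
  have hT1 : ∀ g : MvPolynomial σ K, Φ (linSubst σ K (1 + Matrix.single i j (1 : K)) g) =
      (Φ g).comp (Polynomial.X + Polynomial.C c) := by
    intro g
    change (Φ.toAlgHom.comp (linSubst σ K (1 + Matrix.single i j (1 : K)))) g =
      (((Polynomial.aeval (Polynomial.X + Polynomial.C c)).restrictScalars K).comp Φ.toAlgHom) g
    congr 1
    refine MvPolynomial.algHom_ext fun k => ?_
    change Φ (linSubst σ K (1 + Matrix.single i j (1 : K)) (X k)) =
      Polynomial.aeval (Polynomial.X + Polynomial.C c) (Φ (X k))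
    rw [linSubst_transvection_X hij, ← Polynomial.comp_eq_aeval]
    by_cases hk : k = j
    · subst hk
      rw [if_pos rfl, map_add, hΦj, hΦk i hij, Polynomial.X_comp, hc_def]
    · rw [if_neg hk, hΦk k hk, Polynomial.C_comp]
  -- and `x_j ↦ c_p(x_j)` with `X ↦ c_p(X)`
  have hT2 : ∀ G : MvPolynomial σ K,
      Φ (bind₁ (fun k : σ => if k = j then X j ^ p - X i ^ (p - 1) * X j else X k) G) =
      (Φ G).comp (Polynomial.X ^ p - Polynomial.C (c ^ (p - 1)) * Polynomial.X) := by
    intro G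
    change (Φ.toAlgHom.comp (bind₁ (fun k : σ => if k = j then X j ^ p - X i ^ (p - 1) * X j else X k)))
        G = (((Polynomial.aeval (Polynomial.X ^ p - Polynomial.C (c ^ (p - 1)) * Polynomial.X)).restrictScalars
        K).comp Φ.toAlgHom) G
    congr 1
    refine MvPolynomial.algHom_ext fun k => ?_
    change Φ (bind₁ _ (X k)) = Polynomial.aeval _ (Φ (X k))
    rw [bind₁_X_right, ← Polynomial.comp_eq_aeval]
    by_cases hk : k = j
    · subst hk
      rw [if_pos rfl, map_sub, map_mul, map_pow, map_pow, hΦj, hΦk i hij, Polynomial.X_comp, hc_def,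
        Polynomial.C_pow]
    · rw [if_neg hk, hΦk k hk, Polynomial.C_comp]
  -- apply § 1 to `Φ h`
  have hinv : (Φ h).comp (Polynomial.X + Polynomial.C c) = Φ h := by rw [← hT1, hh]
  obtain ⟨g, hg⟩ := exists_eq_comp_transvectionPoly p hc (Φ h).natDegree (Φ h) le_rfl hinv
  refine ⟨Φ.symm g, Φ.injective ?_⟩
  rw [hT2, AlgEquiv.apply_symm_apply, ← hg]

end Transport

/-! ### § 3 Grading: the fixed forms of degree `D` -/

section Graded

open _root_.MvPolynomial

variable {σ : Type*} [Fintype σ] [DecidableEq σ] {K : Type*} [Field K]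

/-- The substituted monomial `x^e (x_j ↦ c_p(x_j))` is a form of degree `|e| + (p-1) e_j`
(`c_p(x_j) = x_j^p - x_i^{p-1} x_j` is a form of degree `p`). [cite: NeuselSmith2010, §6.3 Example 1
(p0167)] -/
theorem isHomogeneous_bind₁_transvectionGen_monomial {p : ℕ} (hp : 1 ≤ p) (i j : σ) (e : σ →₀ ℕ) :
    (bind₁ (fun k : σ => if k = j then X j ^ p - X i ^ (p - 1) * X j else (X k : MvPolynomial σ K))
      (monomial e 1)).IsHomogeneous (e.degree + (p - 1) * e j) := by
  classical
  have hθ : ∀ k : σ, ((fun k : σ => if k = j then X j ^ p - X i ^ (p - 1) * X j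
      else (X k : MvPolynomial σ K)) k).IsHomogeneous (if k = j then p else 1) := by
    intro k
    by_cases hk : k = j
    · simp only [hk, if_true]
      have h1 := (isHomogeneous_X K j).pow p
      have h2 := ((isHomogeneous_X K i).pow (p - 1)).mul (isHomogeneous_X K j)
      rw [one_mul] at h1 h2
      rw [Nat.sub_add_cancel hp] at h2
      exact h1.sub h2
    · simp only [hk, if_false]
      exact isHomogeneous_X K k
  rw [bind₁_monomial, map_one, one_mul]
  have hprod := IsHomogeneous.prod e.support
    (fun k => (fun k : σ => if k = j then X j ^ p - X i ^ (p - 1) * X j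
      else (X k : MvPolynomial σ K)) k ^ e k)
    (fun k => (if k = j then p else 1) * e k) fun k _ => (hθ k).pow (e k)
  have hsum : ∑ k ∈ e.support, (if k = j then p else 1) * e k = e.degree + (p - 1) * e j := by
    have h1 : ∀ k ∈ e.support, (if k = j then p else 1) * e k =
        e k + (if k = j then (p - 1) * e j else 0) := by
      intro k _
      by_cases hk : k = j
      · subst hk
        simp only [if_true]
        rw [← Nat.sub_add_cancel hp, Nat.add_sub_cancel, Nat.add_mul, one_mul, add_comm]
      · simp [hk]
    rw [Finset.sum_congr rfl h1, Finset.sum_add_distrib, Finset.sum_ite_eq' e.support j,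
      Finsupp.degree_eq_sum, ← Finset.sum_subset (Finset.subset_univ e.support)
        (fun k _ hk => Finsupp.notMem_support_iff.mp hk)]
    by_cases hj : j ∈ e.support
    · rw [if_pos hj]
    · rw [if_neg hj, Finsupp.notMem_support_iff.mp hj, mul_zero]
  rw [hsum] at hprod
  exact hprod

/-- **A form of degree `D` fixed by the transvection lies in the span of the substituted monomials
`x^e (x_j ↦ c_p(x_j))` with `|e| + (p-1) e_j = D`** (take the degree-`D` component of
`h = G(x_j ↦ c_p(x_j))` monomial by monomial). [cite: NeuselSmith2010, §6.3 Example 1 (p0167)] -/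
theorem mem_map_restrictSupport_of_linSubst_transvection_eq {p : ℕ} [Fact p.Prime] [CharP K p]
    {i j : σ} (hij : i ≠ j) {D : ℕ} {h : MvPolynomial σ K} (hD : h.IsHomogeneous D)
    (hh : linSubst σ K (1 + Matrix.single i j (1 : K)) h = h) :
    h ∈ (restrictSupport K (↑(((Finset.range (D + 1)).biUnion (degMonomials σ)).filter
        fun e : σ →₀ ℕ => e.degree + (p - 1) * e j = D) : Set (σ →₀ ℕ))).map
      (bind₁ (fun k : σ => if k = j then X j ^ p - X i ^ (p - 1) * X j
        else (X k : MvPolynomial σ K))).toLinearMap := by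
  classical
  have hp : 1 ≤ p := (Fact.out : p.Prime).one_le
  obtain ⟨G, hG⟩ := exists_eq_bind₁_of_linSubst_transvection_eq hij hh
  set θ : σ → MvPolynomial σ K := fun k : σ => if k = j then X j ^ p - X i ^ (p - 1) * X j else X k
    with hθ
  set T := ((Finset.range (D + 1)).biUnion (degMonomials σ)).filter
    fun e : σ →₀ ℕ => e.degree + (p - 1) * e j = D with hT
  -- `h = ∑_{e} G_e · (x^e ∘ θ)`, then take the degree-`D` component
  have h1 : h = ∑ e ∈ G.support, coeff e G • homogeneousComponent D (bind₁ θ (monomial e 1)) := by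
    conv_lhs => rw [← homogeneousComponent_eq_self hD, hG, G.as_sum, map_sum, map_sum]
    refine Finset.sum_congr rfl fun e _ => ?_
    rw [show monomial e (coeff e G) = coeff e G • monomial e (1 : K) by
        rw [smul_monomial, smul_eq_mul, mul_one],
      map_smul, map_smul]
  have h2 : ∀ e ∈ G.support, coeff e G • homogeneousComponent D (bind₁ θ (monomial e 1)) =
      if D = e.degree + (p - 1) * e j then coeff e G • bind₁ θ (monomial e 1) else 0 := by
    intro e _
    rw [homogeneousComponent_of_mem (isHomogeneous_bind₁_transvectionGen_monomial hp i j e)]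
    split_ifs with h
    · rfl
    · rw [smul_zero]
  rw [h1, Finset.sum_congr rfl h2, ← Finset.sum_filter]
  refine Submodule.sum_mem _ fun e he => Submodule.smul_mem _ _ (Submodule.mem_map_of_mem ?_)
  rw [Finset.mem_filter] at he
  refine (monomial_mem_restrictSupport K).mpr (Or.inl ?_)
  rw [hT, Finset.coe_filter, Set.mem_setOf_eq]
  refine ⟨Finset.mem_biUnion.mpr ⟨e.degree, Finset.mem_range.mpr ?_, mem_degMonomials_iff.mpr rfl⟩,
    he.2.symm⟩
  have := he.2
  omega

/-- **`dim (Sym^D K^σ)^{τ₀} ≤ #T`** for the transvection `τ₀ = 1 + E_{ij}` in characteristic `p`,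
`T = {e : |e| + (p-1) e_j = D}` (the forms fixed by `τ₀` of degree `D` are spanned by the
`x^{e} (x_j ↦ c_p(x_j))`, `e ∈ T`). The fixed-space bound for the transvection class in the
Matsumura–Monsky count. [cite: NeuselSmith2010, §6.3 Example 1 (p0167)] -/
theorem finrank_fixedForms_transvection_le_card {p : ℕ} [Fact p.Prime] [CharP K p] {i j : σ}
    (hij : i ≠ j) (D : ℕ) :
    Module.finrank K ↥(homogeneousSubmodule σ K D ⊓
        LinearMap.ker ((linSubst σ K (1 + Matrix.single i j (1 : K))).toLinearMap - LinearMap.id)) ≤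
      (((Finset.range (D + 1)).biUnion (degMonomials σ)).filter
        fun e : σ →₀ ℕ => e.degree + (p - 1) * e j = D).card := by
  classical
  set T := ((Finset.range (D + 1)).biUnion (degMonomials σ)).filter
    fun e : σ →₀ ℕ => e.degree + (p - 1) * e j = D with hT
  set θ : σ → MvPolynomial σ K := fun k : σ => if k = j then X j ^ p - X i ^ (p - 1) * X j else X k
    with hθ
  haveI : FiniteDimensional K ↥(restrictSupport K (↑T : Set (σ →₀ ℕ))) :=
    Module.Finite.of_basis (basisRestrictSupport K (↑T : Set (σ →₀ ℕ)))
  have hrank : Module.finrank K ↥(restrictSupport K (↑T : Set (σ →₀ ℕ))) = T.card := by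
    rw [Module.finrank_eq_card_basis (basisRestrictSupport K (↑T : Set (σ →₀ ℕ)))]
    simp only [Finset.coe_sort_coe, Fintype.card_coe]
  have hle : homogeneousSubmodule σ K D ⊓
      LinearMap.ker ((linSubst σ K (1 + Matrix.single i j (1 : K))).toLinearMap - LinearMap.id) ≤
      (restrictSupport K (↑T : Set (σ →₀ ℕ))).map (bind₁ θ).toLinearMap := by
    intro h hh
    obtain ⟨hD, hker⟩ := Submodule.mem_inf.mp hh
    rw [LinearMap.mem_ker, LinearMap.sub_apply, LinearMap.id_apply, AlgHom.toLinearMap_apply,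
      sub_eq_zero] at hker
    exact mem_map_restrictSupport_of_linSubst_transvection_eq hij
      ((mem_homogeneousSubmodule D h).mp hD) hker
  calc Module.finrank K ↥(homogeneousSubmodule σ K D ⊓
        LinearMap.ker ((linSubst σ K (1 + Matrix.single i j (1 : K))).toLinearMap - LinearMap.id))
      ≤ Module.finrank K ↥((restrictSupport K (↑T : Set (σ →₀ ℕ))).map (bind₁ θ).toLinearMap) :=
        Submodule.finrank_mono hle
    _ ≤ Module.finrank K ↥(restrictSupport K (↑T : Set (σ →₀ ℕ))) := Submodule.finrank_map_le _ _
    _ = T.card := hrank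

end Graded

end Literature.Computability.AlgebraicComplexity

end
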